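import Literature.AlgebraicGeometry.Limits.ClosedSubschemes
import Mathlib.AlgebraicGeometry.Morphisms.Flat
import Mathlib.RingTheory.Flat.FaithfullyFlat.Algebra
import HarnessLib

/-!
# Pull-back of ideal sheaves: the affine chart formula, and faithfully flat uniqueness

Topic: `Literature/AlgebraicGeometry/Limits`. For a morphism `π : X → Y` and a quasi-coherent
ideal sheaf `𝒦` on `Y` with closed subscheme `Z = V(𝒦)`, Mathlib's `𝒦.comap π` is the ideal of
the base change `X ×_Y Z ↪ X`. We prove the affine chart formula

* `ideal_comap_eq_map` — for an affine open `U ⊆ Y` with affine preimage `π⁻¹ U`,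
  `(𝒦.comap π)(π⁻¹ U) = 𝒦(U) · Γ(π⁻¹ U)` (Görtz–Wedhorn I, §(4.11) and Example 4.36: for
  `f : Spec B → Spec A` and `Z = V(𝔞)`, "we have an identity of closed subschemes
  `f⁻¹(V(𝔞)) = V(𝔞B)`"),

by mapping the affine scheme `Spec (Γ(π⁻¹U) ⧸ 𝒦(U)Γ(π⁻¹U))` to the fibre product, and deduce

* `le_of_comap_le_comap`, `comap_injective` — **fpqc uniqueness of closed subschemes**: along
  an affine, flat and surjective `π` (e.g. the base change of a field extension), `𝒦 ↦ 𝒦.comap π`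
  is an order embedding (closed subschemes descend uniquely along faithfully flat
  quasi-compact morphisms; here via `Ideal.comap_map_eq_self_of_faithfullyFlat`).

## References

* U. Görtz, T. Wedhorn, *Algebraic Geometry I: Schemes*, 2nd ed. (2020), §(4.11) and
  Example 4.36 (p. 139); §(14.12) (faithfully flat descent). [GortzWedhorn2020]
* A. Grothendieck, J. Dieudonné, EGA I (1960), 4.4.5; EGA IV₂ (1965), 2.7.1.
-/

noncomputable section

universe u

open CategoryTheory CategoryTheory.Limits AlgebraicGeometry TopologicalSpace

namespace Literature.AlgebraicGeometry.Limits

set_option backward.isDefEq.respectTransparency false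

open Scheme.IdealSheafData

variable {X Y : Scheme.{u}} (π : X ⟶ Y) (𝒦 : Y.IdealSheafData)

/-- **The affine chart formula for the pull-back ideal sheaf**: for an affine open `U ⊆ Y` whose
preimage `V = π⁻¹ U` is affine, `(𝒦.comap π)(V)` is the extension `𝒦(U) · Γ(X, V)` of `𝒦(U)`
along `π^* : Γ(Y, U) → Γ(X, V)` (Görtz–Wedhorn I, Example 4.36: "`f⁻¹(V(𝔞)) = V(𝔞B)`" for
`f : Spec B → Spec A`).
Proof of `⊆`: the affine scheme `T = Spec (Γ(V) ⧸ 𝒦(U)Γ(V))` maps compatibly to `X` and to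
`V(𝒦)`, hence to `X ×_Y V(𝒦)`, so a section of `𝒪_X(V)` vanishing on `X ×_Y V(𝒦)` vanishes on
`T`, i.e. lies in `𝒦(U)Γ(V)`; `⊇` is `map_mem_comap_ideal`.
[cite: GortzWedhorn2020, Example 4.36 (p. 139)] -/
theorem ideal_comap_eq_map (U : Y.affineOpens) (V : X.affineOpens)
    (hV : (V : X.Opens) = π ⁻¹ᵁ (U : Y.Opens)) :
    (𝒦.comap π).ideal V = (𝒦.ideal U).map (π.appLE U V hV.le).hom := by
  have hVa : IsAffineOpen (π ⁻¹ᵁ (U : Y.Opens)) := hV ▸ V.2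
  have hVeq : V = ⟨π ⁻¹ᵁ (U : Y.Opens), hVa⟩ := Subtype.ext hV
  subst hVeq
  apply le_antisymm
  · -- `⊆`
    intro s hs
    let R := Γ(Y, (U : Y.Opens))
    let S := Γ(X, π ⁻¹ᵁ (U : Y.Opens))
    let K : Ideal R := 𝒦.ideal U
    let φ : R →+* S := (π.appLE U (π ⁻¹ᵁ (U : Y.Opens)) le_rfl).hom
    let KS : Ideal S := K.map φ
    -- the test scheme `T = Spec (S ⧸ KS)` and its maps to `X` and to `V(𝒦)`
    let ι := 𝒦.subschemeι
    let a : Spec (.of (S ⧸ KS)) ⟶ X :=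
      Spec.map (CommRingCat.ofHom (Ideal.Quotient.mk KS)) ≫ hVa.fromSpec
    have hKle : K ≤ KS.comap φ := Ideal.le_comap_map
    let b : Spec (.of (S ⧸ KS)) ⟶ 𝒦.subscheme :=
      Spec.map (CommRingCat.ofHom (Ideal.quotientMap KS φ hKle)) ≫ 𝒦.subschemeCover.f U
    have hab : a ≫ π = b ≫ ι := by
      have h1 : 𝒦.subschemeCover.f U ≫ ι =
          Spec.map (CommRingCat.ofHom (Ideal.Quotient.mk K)) ≫ U.2.fromSpec := by
        rw [subschemeCover_map_subschemeι, glueDataObjι_ι]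
      simp only [a, b, Category.assoc, h1]
      rw [← IsAffineOpen.SpecMap_appLE_fromSpec π U.2 hVa le_rfl, ← Spec.map_comp_assoc,
        ← Spec.map_comp_assoc]
      rfl
    let τ : Spec (.of (S ⧸ KS)) ⟶ pullback π ι := pullback.lift a b hab
    have hτ : τ ≫ pullback.fst π ι = a := pullback.lift_fst _ _ _
    -- `s` vanishes on `T`
    have hs0 : (pullback.fst π ι).app (π ⁻¹ᵁ (U : Y.Opens)) s = 0 := by
      have : s ∈ (pullback.fst π ι).ker.ideal ⟨π ⁻¹ᵁ (U : Y.Opens), hVa⟩ := hs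
      rwa [Scheme.Hom.ker_apply, RingHom.mem_ker] at this
    have ha0 : a.app (π ⁻¹ᵁ (U : Y.Opens)) s = 0 := by
      rw [Scheme.Hom.congr_app hτ.symm, Scheme.Hom.comp_app]
      change (Spec (.of (S ⧸ KS))).presheaf.map _ (τ.app _ ((pullback.fst π ι).app _ s)) = 0
      rw [hs0, map_zero, map_zero]
    -- compute `a^*` on `V`: it is the quotient map
    have hV1 : hVa.fromSpec ⁻¹ᵁ (π ⁻¹ᵁ (U : Y.Opens)) = ⊤ := hVa.fromSpec_preimage_self
    have haV : a ⁻¹ᵁ (π ⁻¹ᵁ (U : Y.Opens)) = ⊤ := by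
      simp only [a, Scheme.Hom.comp_preimage, hV1]
      rfl
    have h2 : hVa.fromSpec.appLE (π ⁻¹ᵁ (U : Y.Opens)) ⊤ hV1.ge = (Scheme.ΓSpecIso S).inv := by
      rw [Scheme.Hom.appLE, hVa.fromSpec_app_of_le _ le_rfl]
      simp only [Category.assoc, ← Functor.map_comp]
      have e1 : (homOfLE (le_refl (π ⁻¹ᵁ (U : Y.Opens)))).op = 𝟙 _ := Subsingleton.elim _ _
      rw [e1, X.presheaf.map_id, Category.id_comp]
      have e2 : ((homOfLE (le_top (a := hVa.fromSpec ⁻¹ᵁ π ⁻¹ᵁ (U : Y.Opens)))).op ≫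
          (homOfLE hV1.ge).op) = 𝟙 _ := Subsingleton.elim _ _
      rw [e2, (Spec S).presheaf.map_id, Category.comp_id]
    have h3 : (Spec.map (CommRingCat.ofHom (Ideal.Quotient.mk KS))).appLE ⊤ ⊤ le_rfl =
        (Spec.map (CommRingCat.ofHom (Ideal.Quotient.mk KS))).appTop := by
      rw [Scheme.Hom.appTop, Scheme.Hom.app_eq_appLE]
      rfl
    have ha : a.appLE (π ⁻¹ᵁ (U : Y.Opens)) ⊤ haV.ge =
        CommRingCat.ofHom (Ideal.Quotient.mk KS) ≫ (Scheme.ΓSpecIso (.of (S ⧸ KS))).inv := by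
      have hc := Scheme.Hom.appLE_comp_appLE (Spec.map (CommRingCat.ofHom (Ideal.Quotient.mk KS)))
        hVa.fromSpec (π ⁻¹ᵁ (U : Y.Opens)) ⊤ ⊤ hV1.ge le_rfl
      rw [h2, h3, ← Scheme.ΓSpecIso_inv_naturality] at hc
      rw [hc]
    have : a.appLE (π ⁻¹ᵁ (U : Y.Opens)) ⊤ haV.ge s = 0 := by
      rw [Scheme.Hom.appLE, CategoryTheory.comp_apply, ha0, map_zero]
    rw [ha, CategoryTheory.comp_apply] at this
    have h4 : Ideal.Quotient.mk KS s = 0 := by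
      have h5 := congrArg (Scheme.ΓSpecIso (.of (S ⧸ KS))).hom this
      simpa only [Iso.inv_hom_id_apply, map_zero, CommRingCat.hom_ofHom] using h5
    exact Ideal.Quotient.eq_zero_iff_mem.mp h4
  · -- `⊇`
    rw [Ideal.map_le_iff_le_comap]
    intro x hx
    rw [Ideal.mem_comap]
    have h := map_mem_comap_ideal π 𝒦 U hVa hx
    have e : π.appLE U (π ⁻¹ᵁ (U : Y.Opens)) le_rfl = π.app U := π.appLE_eq_app
    rw [e]
    exact h

/-- The chart formula in the form `V = π⁻¹ U` on the nose. [folklore] -/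
theorem ideal_comap_preimage (U : Y.affineOpens) (hV : IsAffineOpen (π ⁻¹ᵁ (U : Y.Opens))) :
    (𝒦.comap π).ideal ⟨π ⁻¹ᵁ (U : Y.Opens), hV⟩ = (𝒦.ideal U).map (π.app U).hom := by
  rw [ideal_comap_eq_map π 𝒦 U ⟨π ⁻¹ᵁ (U : Y.Opens), hV⟩ rfl, π.appLE_eq_app]

/-! ## Faithfully flat uniqueness -/

/-- Over an affine open `U`, an affine, flat and surjective morphism is given by a faithfully
flat ring map `Γ(U) → Γ(π⁻¹ U)`. [folklore] -/
theorem faithfullyFlat_app [IsAffineHom π] [Flat π] [Surjective π] (U : Y.affineOpens) :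
    (π.app U).hom.FaithfullyFlat := by
  have hV : IsAffineOpen (π ⁻¹ᵁ (U : Y.Opens)) := U.2.preimage π
  have hflat : (π.appLE U (π ⁻¹ᵁ (U : Y.Opens)) le_rfl).hom.Flat :=
    HasRingHomProperty.appLE @Flat π inferInstance U ⟨_, hV⟩ le_rfl
  rw [π.appLE_eq_app] at hflat
  rw [← flat_and_surjective_SpecMap_iff]
  refine ⟨(HasRingHomProperty.Spec_iff (P := @Flat)).mpr hflat, ⟨fun u => ?_⟩⟩
  -- surjectivity of `Spec Γ(π⁻¹U) → Spec Γ(U)` from that of `π`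
  have hsq : Spec.map (π.app U) ≫ U.2.fromSpec = hV.fromSpec ≫ π := by
    rw [← π.appLE_eq_app]
    exact IsAffineOpen.SpecMap_appLE_fromSpec π U.2 hV le_rfl
  obtain ⟨x, hx⟩ := π.surjective (U.2.fromSpec u)
  have hxV : x ∈ π ⁻¹ᵁ (U : Y.Opens) := by
    change π x ∈ (U : Y.Opens)
    rw [hx, ← SetLike.mem_coe, ← U.2.range_fromSpec]
    exact ⟨u, rfl⟩
  obtain ⟨v, rfl⟩ : x ∈ Set.range hV.fromSpec := by rwa [IsAffineOpen.range_fromSpec]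
  refine ⟨v, U.2.fromSpec.isOpenEmbedding.injective ?_⟩
  rw [← Scheme.Hom.comp_apply, hsq, Scheme.Hom.comp_apply, hx]

/-- **Faithfully flat uniqueness for closed subschemes** (the uniqueness half of fpqc descent
of closed subschemes / quasi-coherent ideals): along an affine, flat and surjective morphism
`π : X → Y`, `𝒦₁.comap π ≤ 𝒦₂.comap π` implies `𝒦₁ ≤ 𝒦₂` — on an affine `U`,
`𝒦ᵢ(U) = 𝒦ᵢ(U)Γ(π⁻¹U) ∩ Γ(U)` by faithful flatness of `Γ(U) → Γ(π⁻¹U)` (Mathlib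
`Ideal.comap_map_eq_self_of_faithfullyFlat`). [folklore] -/
theorem le_of_comap_le_comap [IsAffineHom π] [Flat π] [Surjective π] {𝒦₁ 𝒦₂ : Y.IdealSheafData}
    (h : 𝒦₁.comap π ≤ 𝒦₂.comap π) : 𝒦₁ ≤ 𝒦₂ := by
  intro U
  have hV : IsAffineOpen (π ⁻¹ᵁ (U : Y.Opens)) := U.2.preimage π
  have h1 := h ⟨_, hV⟩
  rw [ideal_comap_preimage π 𝒦₁ U hV, ideal_comap_preimage π 𝒦₂ U hV] at h1
  have hff := faithfullyFlat_app π U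
  algebraize [(π.app U).hom]
  rw [← Ideal.comap_map_eq_self_of_faithfullyFlat (B := Γ(X, π ⁻¹ᵁ (U : Y.Opens))) (𝒦₁.ideal U),
    ← Ideal.comap_map_eq_self_of_faithfullyFlat (B := Γ(X, π ⁻¹ᵁ (U : Y.Opens))) (𝒦₂.ideal U)]
  exact Ideal.comap_mono h1

/-- Along an affine, flat and surjective morphism, pull-back of ideal sheaves is injective.
[folklore] -/
theorem comap_injective [IsAffineHom π] [Flat π] [Surjective π] :
    Function.Injective fun 𝒦 : Y.IdealSheafData => 𝒦.comap π := fun _ _ h =>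
  le_antisymm (le_of_comap_le_comap π h.le) (le_of_comap_le_comap π h.ge)

/-- Along an affine, flat and surjective morphism, pull-back of ideal sheaves reflects the order.
[folklore] -/
theorem comap_le_comap_iff [IsAffineHom π] [Flat π] [Surjective π] {𝒦₁ 𝒦₂ : Y.IdealSheafData} :
    𝒦₁.comap π ≤ 𝒦₂.comap π ↔ 𝒦₁ ≤ 𝒦₂ :=
  ⟨le_of_comap_le_comap π, fun h => comap_mono π h⟩

end Literature.AlgebraicGeometry.Limits

end
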